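import Summits.BirchSwinnertonDyer.BirchSwinnertonDyer.Theorems.ByReductionTypeAtTwoLowerHalfDescentCore
import Summits.BirchSwinnertonDyer.Rank1Residual.X11b.KrausMinimalityGeneralTwo
import Summits.BirchSwinnertonDyer.BirchSwinnertonDyer.Theorems.Rank1ResidualIntModelSurjectivity
import Summits.BirchSwinnertonDyer.BirchSwinnertonDyer.Theorems.Rank1ResidualIntModelReduction
import Summits.BirchSwinnertonDyer.Rank1Residual.Supersingular.SurjFrobeniusOrderCertificateShape
import Summits.BirchSwinnertonDyer.Rank1Residual.Additive.X4ThreeResCertKernel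
import Summits.BirchSwinnertonDyer.Rank1Residual.Additive.PotSupersingularClasses
import Literature.NumberTheory.EllipticCurves.BSDRankZeroDensityProofs
import Literature.NumberTheory.EllipticCurves.MazurTorsionGaloisStructureProofs
import Literature.NumberTheory.EllipticCurves.NonEisensteinPrimeOfSurjective
import HarnessLib

/-!
# Route `RamifiedHeegnerPair` — TURNKEY L₁ at the INTRINSIC Gss2 rank-one classes: the lower half
# `ord₃ #Ш_an(W) ≤ ord₃ #Ш(W)` at `p = 3` for `133956n1, 169848k1, 182853c1, 205128l1, 205128l2,
# 228897c1, 250065g1, 355338h1, 409248cy1, 439794p1` from a RIGOROUS FULL 3-DESCENT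
# (`27 ∣ #Sel^(3)(W/ℚ)`, displayed certificate) + Gross–Zagier–Kolyvagin (tribunal-w `bsd-trib-w-rhp` g8;
# answers `Cruxes/RamifiedPairLowerBound/TURNKEY-L1-INTRINSIC9.md` of the X1 lead)

HONEST FRAMING. BSD is NOT proved. Nothing about the deciding crux `RamifiedPairLowerBound` (X1, item
23191) or its rank-one additive member L₁ = `Sig.stub_gssLowerAtThree_rankOne` of
`Cruxes/RamifiedPairLowerBound/Lines/birth.lean` (= Option-B child `Gss2LowerAtThreeRankOne`) IN GENERAL is
claimed: L₁ is a `∀ W`-statement and stays open. This file (§1: the kernel algebra, any curve, any prime) and its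
three companions `RamifiedHeegnerPairL1IntrinsicA|B|C.lean` (the per-curve records; the 400-line lint forces the
split) prove its BODY at the ten curves above — curve 1 of
each of the NINE non-CM Gss2 classes of analytic rank `1` in the census window `N < 5·10⁵` that are INTRINSIC
(`ord₃ #Ш_an(W′) > 0` at every member; classes `133956n, 169848k, 182853c, 205128l, 228897c, 250065g, 355338h,
409248cy, 439794p`, all singletons except the `2`-isogenous pair `205128l1 ~ 205128l2`, both treated) — i.e. the
rows `hintr` (`r = 1`) of `RamifiedPairLowerBound.gssLowerAtThree_of_intrinsicRows` (p606339), each under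
DISPLAYED binders of exactly the evidence grade of every descent / Kolyvagin record of the cell:

* `hGZK` = `rank_eq_analyticRank_of_analyticRank_le_one` (bsd.S17, Gross–Zagier–Kolyvagin: the tree's named fact);
* `hr : ord_{s=1} L(W,s) = 1` [cite: Cremona2006, Table 1] (inside `l1_at_<label>` it is L₁'s own antecedent);
* `hq, hv : #Ш_an(W) = q ∈ ℚ with ord₃ q ≤ 2` — the numerical value `#Ш_an = 9.0000` of Cremona's `allbsd`
  table is DISPLAYED, never asserted (as in every record of the cell; an `ord₃ ≤ 2` reading suffices);
* `hSel : 3³ ∣ #Sel^(3)(W/ℚ)` — the 3-DESCENT CERTIFICATE, in the tree's Selmer currency `W.selmerGroup 3`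
  (`Literature/…/BSDSelmer`): THREE independent classes of `Sel^(3)(W/ℚ) ⊂ A^×/A^{×3}` exhibited and verified
  by the engine `desc3.py` (this seat; Sage 10.9 + PARI, no Magma) on the compute pool, jobs `j300939`
  (+ `j302517` for `250065g1`, `355338h1`, whose unit groups need PARI's compact representation: `A(S,3)` from
  `bnfinit`/`bnfunits` in factored form with exponents reduced mod `3`), method of Schaefer–Stoll [cite: SchaeferStoll2004, Cor. 5.9, Prop. 5.10,
  Prop. 3.2 and §7.1]: `A = ℚ(T)` the étale algebra of `E[3] ∖ {0}` (an octic field here: `ρ̄₃` is onto),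
  `H¹(ℚ, E[3]) = ker(g − σ_g) ∩ ker ū ⊂ A^×/A^{×3}` (Cor. 5.9; `ū` = norm from the algebra `D` of flags `P ∈ ℓ`
  to the algebra `B` of affine lines missing `0`, Prop. 5.10), `Sel^(3) = {ξ ∈ H¹(ℚ, E[3]; S) : res_v ξ ∈ δ_v(E(ℚ_v)/3)
  ∀ v ∈ S}`, `S = {3} ∪ {v : 3 ∣ c_v}` (Prop. 3.2), local images found by sampling `E(ℚ_v)` to the a-priori
  dimension `dim E(ℚ_v)[3] (+1 at v = 3)` (§7.1). RIGOUR OF THE LOWER BOUND: candidate classes come from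
  `A(S,3)` (PARI `bnfinit`, GRH — used ONLY to enumerate candidates); each of the three basis classes is then
  checked UNCONDITIONALLY: unramified outside `S` by ideal factorisation, `a·ι(a) ∈ A^{×3}` and `N_{D/B}(a) ∈ B^{×3}`
  by EXACT cube roots in `A`, `B`, and the local conditions by injective `𝔽₃`-coordinates
  (`v_𝔓 mod 3`, discrete logs in `(𝒪/𝔓^k)^× ⊗ 𝔽₃`, `k = ⌊3e/2⌋ + 1` above `3`) against the span of the images of
  sampled local points (precision-certified); and the three verified classes are INDEPENDENT in `A^×/A^{×3}`
  GRH-free (cubic residue characters at auxiliary degree-one primes separate them; jobs `j302517`, `j302095`).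
  Hence `dim_𝔽₃ Sel^(3)(W/ℚ) ≥ 3` unconditionally (`= 3` granted GRH).
  The `H¹`-exactness of the criterion and the injectivity of the local/inertial restrictions were re-verified by a
  finite group-cohomology computation over all `55` subgroups of `GL₂(𝔽₃)` (`cohcheck.py`, attached as evidence).
  VALIDATION (same job, same code path): `dim Sel^(3)` = `0, 1, 2, 3` for `11a1, 37a1, 389a1, 5077a1` (ranks
  `0–3`, `Ш[3] = 0`), `2` for `681b1`, `1913b1` (rank `0`, `#Ш_an = 9`), `1, 0` for `92b1`, `116a1` (`3 ∣ c₂`), `1` for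
  `360e1`, `414d1` (rank `1`, additive `I₀*` at `3`) — all as predicted.
  PRIOR ART IN THE TREE (independent engines, same verdict `27 ∣ #Sel^(3)`): lane `bsd-addord-k1-c3x` certified an
  exhibited subgroup of order `27` GRH-free for eight of these curves (all but `169848k1`, `205128l2`; two engines,
  kit `j293463`/`j293581`, bundle `pub/bsd-addord/k1-c3x/desc3-g6/`) and landed FULL `BSD(E,3)` records
  `…AdditiveBranchIMCGordTwoRankOne.HeegnerKolyvagin.bsdp_g<label>_3` for seven of them under the larger binder set of
  the Heegner–Kolyvagin door; `169848k1` has the visibility record `Visibility.missingLowerBoundAt_c169848k1_3_of_congr`.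
  The present files are a THIRD engine (dimensions agree `8/8`), cover all ten curves, and state the L₁ shape with the
  minimal binder set; instance facts already landed there are reused by name, not restated.

DECIDED in the companions (kernel, `decide`): `Δ ≠ 0`; global minimality (support-form Kraus criterion); the integral model;
`W` ADDITIVE at `3` (`v₃(Δ) = 6`, `v₃(c₄) = 3`: Kodaira `I₀*`, the scope of L₁); `ρ̄_{W,3}` ONTO `GL₂(𝔽₃)` by two
Frobenius witnesses, whence `E[3]` irreducible and `E(ℚ)[3] = 0` (`torsionBy_eq_bot_of_irr`, Mazur). NOT decided:
`SubGss W 3`, `¬CM` (antecedents of L₁, simply assumed — the conclusion does not need them).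

KERNEL ALGEBRA (§1 below, any prime, reusable): `missingLowerBoundAt_of_pow_dvd_natCard_selmerGroup` — the
SELMER-currency door at analytic rank `1`: `p^{m+1} ∣ #Sel^(p)`, `E[p]` irreducible, `#Ш_an = q`, `ord_p q ≤ m`
⇒ `MissingLowerBoundAt E p`, via the exact descent count `#Sel^(p) = p^{rank}·#E(ℚ)[p]·#Ш[p]`
(`natCard_selmerGroup_eq`, Silverman X.4.2), `rank = r_an = 1` and `Ш` finite (GZK), `#Ш[p] ∣ #Ш`, and the
squareness-free door `LowerHalfDescentCore.missingLowerBoundAt_of_pow_dvd_of_analyticRank_le_one` (no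
Cassels–Tate binder). Axioms: the standard three. No `sorry`. No new definition, no named fact, nothing booked;
no count, tier or mark of any residual class moves; the item 23191 stays OPEN.

| label | `[a₁,a₂,a₃,a₄,a₆]` | `S` | `dim A(S,3)` | `dim Sel^(3)` (verified `≥` / GRH `=`) | job |
|---|---|---|---|---|---|
| 133956n1 | `[0,0,0,33489,-36770922]` | `{2,3}` | 8 | 3 / 3 | j300939 |
| 169848k1 | `[0,0,0,-1757979,-897161130]` | `{3}` | 6 | 3 / 3 | j300939 |
| 182853c1 | `[0,0,1,-522,-9187]` | `{3}` | 6 | 3 / 3 | j300939 |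
| 205128l1 | `[0,0,0,-140542659,-679555229778]` | `{3}` | 6 | 3 / 3 | j300939 |
| 205128l2 | `[0,0,0,-2285741979,-42061737232170]` | `{3}` | 6 | 3 / 3 | j300939 |
| 228897c1 | `[0,0,1,-32274,-2231422]` | `{3}` | 6 | 3 / 3 | j300939 |
| 250065g1 | `[1,-1,0,310800,51948125]` | `{3}` | 7 | 3 / 3 | j302517 |
| 355338h1 | `[1,-1,0,22278,8543762]` | `{3}` | 6 | 3 / 3 | j302517 |
| 409248cy1 | `[0,0,0,-626472,190853712]` | `{3}` | 6 | 3 / 3 | j300939 |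
| 439794p1 | `[1,-1,0,-412053,-101704843]` | `{3}` | 6 | 3 / 3 | j300939 |

With `rank = 1` and `E(ℚ)[3] = 0` each certified row reads `Ш(W/ℚ)[3] ⊇ (ℤ/3)²`, `9 ∣ #Ш(W/ℚ)` — matching
`#Ш_an = 9`. References: E. F. Schaefer, M. Stoll, Trans. AMS 356 (2004) 1209–1231 [SchaeferStoll2004];
J. H. Silverman, *AEC* Thm X.4.2, VII.1, VII.5 [SilvermanAEC2009]; A. Kraus, Manuscripta Math. 65 (1989)
[Kraus1989]; J.-P. Serre, Invent. Math. 15 (1972) §2.4, §5.2 [Serre1972]; B. Mazur, IHÉS 47 (1977) p. 157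
[Mazur1977]; H. Darmon, CBMS 101 Thm. 3.22 (GZK) [Darmon2004]; R. L. Miller, LMS J. Comput. Math. 14 (2011)
Def. 1.1 [Miller2011LMS]; J. E. Cremona, *Algorithms for Modular Elliptic Curves* / ecdata [Cremona2006].
-/

set_option autoImplicit false

noncomputable section

open scoped Classical AddSubgroup

open WeierstrassCurve Literature.NumberTheory.EllipticCurves
  Literature.NumberTheory.EllipticCurves.Rank1Residual
  Literature.NumberTheory.EllipticCurves.Rank1Residual.Typed
  Literature.NumberTheory.EllipticCurves.Rank1Residual.X11RankOneCertificates
  Summit.BirchSwinnertonDyer.BirchSwinnertonDyer.Rank1Residual.X11RankOne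
  Summit.BirchSwinnertonDyer.Rank1Residual.X11b
  Summit.BirchSwinnertonDyer.BirchSwinnertonDyer.Rank1Residual.IntModel
  Summit.BirchSwinnertonDyer.Rank1Residual.Supersingular

namespace Summit.BirchSwinnertonDyer.BirchSwinnertonDyer.Theorems.RamifiedHeegnerPairL1Intrinsic

/-! ## §1 The SELMER-currency door at analytic rank `1` (any prime) -/

/-- **No rational `p`-torsion from irreducibility**: `E[p]` irreducible ⇒ `E(ℚ)[p] = 0` (the line spanned by a
rational point of order `p` is `Γ_ℚ`-stable). [cite: Mazur1977, Ch. III §5, p. 157] -/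
theorem torsionBy_eq_bot_of_irr (W : WeierstrassCurve ℚ) [W.IsElliptic] (p : ℕ) [hp : Fact p.Prime]
    (hirr : W.HasIrreducibleModPGaloisRep p) : W.toAffine.Point[(p : ℤ)] = ⊥ := by
  refine (AddSubgroup.eq_bot_iff_forall _).mpr fun P hP ↦ ?_
  have h3 : (p : ℤ) • P = 0 := by
    rw [natCast_zsmul]; exact AddSubgroup.torsionBy.nsmul_iff.mp hP
  by_contra hne
  have hord : addOrderOf P = p := by
    rw [natCast_zsmul] at h3
    have hdvd : addOrderOf P ∣ p := addOrderOf_dvd_of_nsmul_eq_zero h3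
    rcases (Nat.dvd_prime hp.out).mp hdvd with h1 | h1
    · exact absurd (AddMonoid.addOrderOf_eq_one_iff.mp h1) hne
    · exact h1
  exact not_exists_addOrderOf_eq_of_hasIrreducibleModPGaloisRep W hirr
    ⟨P, (Rank1Residual.addOrderOf_point_eq_of_subsingleton W _ _ P).trans hord⟩

/-- **Selmer-currency door, analytic rank `1`, any prime `p` (no Cassels–Tate binder).** Granted
Gross–Zagier–Kolyvagin (`hGZK` = bsd.S17): if `ord_{s=1} L(E,s) = 1`, `E[p]` is irreducible, `#Ш_an(E) = q ∈ ℚ`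
with `ord_p q ≤ m`, and `p^{m+1} ∣ #Sel^{(p)}(E/ℚ)`, then `ord_p #Ш_an(E) ≤ ord_p #Ш(E)` (`MissingLowerBoundAt E p`).
Proof: the exact descent count `#Sel^{(p)} = p^{rank} · #E(ℚ)[p] · #Ш[p]` (`natCard_selmerGroup_eq`, Silverman X.4.2)
with `rank = r_an = 1` (GZK) and `E(ℚ)[p] = 0` gives `p^m ∣ #Ш[p] ∣ #Ш`, then the squareness-free door
`LowerHalfDescentCore.missingLowerBoundAt_of_pow_dvd_of_analyticRank_le_one`.
[cite: SilvermanAEC2009, Thm X.4.2] [cite: Darmon2004, Thm. 3.22] [cite: Miller2011LMS, Def. 1.1 (arXiv:1010.2431 p. 3)] -/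
theorem missingLowerBoundAt_of_pow_dvd_natCard_selmerGroup (W : WeierstrassCurve ℚ) [W.IsElliptic]
    (p : ℕ) [hp : Fact p.Prime] (hGZK : rank_eq_analyticRank_of_analyticRank_le_one)
    (hr : W.analyticRank = 1) (hirr : W.HasIrreducibleModPGaloisRep p)
    {q : ℚ} (hq : shaAn W = (q : ℂ)) {m : ℕ} (hv : padicValRat p q ≤ m)
    (hSel : p ^ (m + 1) ∣ Nat.card (W.selmerGroup p)) : MissingLowerBoundAt W p := by
  have hp0 : p ≠ 0 := hp.out.ne_zero
  obtain ⟨hrank, hfin⟩ := hGZK W hr.le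
  rw [hr] at hrank
  have hcount := W.natCard_selmerGroup_eq hp0
  have hcard1 : Nat.card (W.toAffine.Point[(p : ℤ)]) = 1 :=
    AddSubgroup.card_eq_one.mpr (torsionBy_eq_bot_of_irr W p hirr)
  -- the descent count is stated with the classical `DecidableEq ℚ` instance on `E(ℚ)`; align the instances
  have hinst : (fun a b ↦ Classical.propDecidable (a = b) : DecidableEq ℚ) = instDecidableEqRat :=
    Subsingleton.elim _ _
  rw [hinst] at hcount
  rw [hrank, pow_one, hcard1, mul_one] at hcount
  rw [hcount, pow_succ, mul_comm (p ^ m) p] at hSel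
  have hdvd' : p ^ m ∣ Nat.card (W.sha ⊓ AddSubgroup.torsionBy W.galH1 p : AddSubgroup W.galH1) :=
    Nat.dvd_of_mul_dvd_mul_left hp.out.pos hSel
  have hdvd : p ^ m ∣ W.shaOrder := hdvd'.trans (AddSubgroup.card_dvd_of_le inf_le_left)
  exact LowerHalfDescentCore.missingLowerBoundAt_of_pow_dvd_of_analyticRank_le_one W p hGZK hr.le hq hv hdvd

/-- **The shape L₁ consumes, any curve**: at `p = 3`, `m = 2` — `27 ∣ #Sel^{(3)}(E/ℚ)`, `E[3]` irreducible,
`r_an = 1`, `#Ш_an = q` with `ord₃ q ≤ 2` ⇒ `MissingLowerBoundAt E 3`, hence the BODY of L₁ at `E` (its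
antecedents `¬CM`, `Addv E 3`, `SubGss E 3` are not used; `r_an = 1` is). [cite: SilvermanAEC2009, Thm X.4.2]
[cite: Miller2011LMS, Def. 1.1] -/
theorem l1Body_of_descent (W : WeierstrassCurve ℚ) [W.IsElliptic] [W.IsGloballyMinimal]
    (hGZK : rank_eq_analyticRank_of_analyticRank_le_one) (hirr : W.HasIrreducibleModPGaloisRep 3)
    {q : ℚ} (hq : shaAn W = (q : ℂ)) (hv : padicValRat 3 q ≤ 2)
    (hSel : 3 ^ 3 ∣ Nat.card (W.selmerGroup 3)) :
    ¬ W.HasCM → Addv W 3 → Summit.BirchSwinnertonDyer.Rank1Residual.Additive.SubGss W 3 → W.analyticRank = 1 →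
      MissingLowerBoundAt W 3 :=
  fun _ _ _ hr ↦ missingLowerBoundAt_of_pow_dvd_natCard_selmerGroup W 3 hGZK hr hirr hq (m := 2)
    (by exact_mod_cast hv) hSel


end Summit.BirchSwinnertonDyer.BirchSwinnertonDyer.Theorems.RamifiedHeegnerPairL1Intrinsic

end
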